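import Summits.RiemannHypothesis.RiemannHypothesis.Theses.SpectralTrace
import Literature.NumberTheory.LFunctions.WeilExplicitFormulaProofs
import Literature.NumberTheory.LFunctions.WeilZeroSum
import HarnessLib

/-!
# `WindowTraceArch` — calibration lemma: the COMPLEX relaxation of the window trace is a theorem

Support lemma for the crux `stmt-RiemannHypothesis-11195`
(`Summit.RiemannHypothesis.RiemannHypothesis.Theses.SpectralTrace.WindowTraceArch`), recorded by
the standing disprover (`Cruxes/WindowTraceArch/Disproof.lean` §3).

The crux asks for a REAL family `γ` with `HasSum (i ↦ ĝ(1/2 + iγ_i)) (W g)` on the window tests.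
Relax `1/2 + iγ_i` (`γ_i ∈ ℝ`) to arbitrary points `s_i ∈ ℂ`: then the statement holds
UNCONDITIONALLY and for ALL Weil tests — the non-trivial zeros of `ζ`, repeated with
multiplicity, do it (`explicit_formula_holds` + absolute convergence `summable_norm_zeroSide`,
regrouped on the sigma type `Σ ρ, Fin m(ρ)` by `HasSum.sigma`). So the reality of the spectrum is
the entire content of the crux (and of the route target `X`); in particular no cheap refutation
can come from the shape of `W` alone.

* `hasSum_weilMellin_zeros` : `HasSum (p ↦ ĝ(ρ_p)) (W g)` over zeros with multiplicity.
* `exists_complex_spectrum` : `∃ (ι) (s : ι → ℂ), ∀ Weil g, HasSum (i ↦ ĝ(s i)) (W g)`.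
-/

noncomputable section

open Complex Set MeasureTheory Filter

namespace Summit.RiemannHypothesis.RiemannHypothesis.Theorems.WindowTraceArch.Negative

open Literature.NumberTheory.LFunctions

/-- Cast bookkeeping: `(m(ρ).toNat : ℂ) = (m(ρ) : ℂ)` on non-trivial zeros (`m(ρ) ≥ 1`). [folklore] -/
theorem cast_order_toNat (ρ : ZetaZeros.riemannZetaNontrivialZeros) :
    (((riemannZetaZeroOrder (ρ : ℂ)).toNat : ℕ) : ℂ) = (riemannZetaZeroOrder (ρ : ℂ) : ℂ) := by
  have h1 := ZetaZeros.riemannZetaNontrivialZeros.one_le_order ρ.2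
  have h2 : ((riemannZetaZeroOrder (ρ : ℂ)).toNat : ℤ) = riemannZetaZeroOrder (ρ : ℂ) :=
    Int.toNat_of_nonneg (by omega)
  exact_mod_cast congrArg (fun z : ℤ => (z : ℂ)) h2

/-- **The zeros with multiplicity are an unconditional complex spectrum for `W`.** For every
Weil test `g`, `HasSum (p ↦ ĝ(ρ_p)) (W g)` over the sigma type of non-trivial zeros repeated
`m(ρ)` times (Guinand–Weil explicit formula with absolute convergence). [folklore] -/
theorem hasSum_weilMellin_zeros {g : ℝ → ℂ} (hg : IsWeilTest g) :
    HasSum (fun p : (Σ ρ : ZetaZeros.riemannZetaNontrivialZeros,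
        Fin (riemannZetaZeroOrder (ρ : ℂ)).toNat) => weilMellin g (p.1 : ℂ))
      (weilFunctional g) := by
  set f : (Σ ρ : ZetaZeros.riemannZetaNontrivialZeros,
      Fin (riemannZetaZeroOrder (ρ : ℂ)).toNat) → ℂ := fun p => weilMellin g (p.1 : ℂ) with hf
  -- fibrewise the sums are finite: `m(ρ) • ĝ(ρ)`
  have hfib : ∀ ρ : ZetaZeros.riemannZetaNontrivialZeros,
      HasSum (fun c : Fin (riemannZetaZeroOrder (ρ : ℂ)).toNat => f ⟨ρ, c⟩)
        ((riemannZetaZeroOrder (ρ : ℂ) : ℂ) * weilMellin g ρ) := by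
    intro ρ
    have h := hasSum_fintype (fun c : Fin (riemannZetaZeroOrder (ρ : ℂ)).toNat => f ⟨ρ, c⟩)
    simp only [hf, Finset.sum_const, Finset.card_univ, Fintype.card_fin, nsmul_eq_mul,
      cast_order_toNat] at h
    exact h
  -- absolute summability on the sigma type
  have hnorm : Summable fun p => ‖f p‖ := by
    rw [summable_sigma_of_nonneg (fun _ => norm_nonneg _)]
    refine ⟨fun ρ => (hasSum_fintype _).summable, ?_⟩
    refine (summable_norm_zeroSide hg).congr fun ρ => ?_
    simp only [hf, tsum_fintype, Finset.sum_const, Finset.card_univ, Fintype.card_fin,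
      nsmul_eq_mul, norm_mul]
    rw [← cast_order_toNat, Complex.norm_natCast]
  have hF : HasSum f (∑' p, f p) := hnorm.of_norm.hasSum
  -- regroup by fibres and compare with the explicit formula
  have hG : HasSum (fun ρ : ZetaZeros.riemannZetaNontrivialZeros =>
      (riemannZetaZeroOrder (ρ : ℂ) : ℂ) * weilMellin g ρ) (∑' p, f p) := hF.sigma hfib
  have hEF : ∑' ρ : ZetaZeros.riemannZetaNontrivialZeros,
      (riemannZetaZeroOrder (ρ : ℂ) : ℂ) * weilMellin g ρ = weilFunctional g :=
    tendsto_nhds_unique (hasWeilZeroSide_tsum (summable_norm_zeroSide hg))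
      (explicit_formula_holds hg)
  have hsum : ∑' p, f p = weilFunctional g := hG.tsum_eq.symm.trans hEF
  rw [← hsum]
  exact hF

/-- **The complex relaxation of the window trace (indeed of `X`) holds unconditionally**: some
complex family reproduces `W` on EVERY Weil test. [folklore] -/
theorem exists_complex_spectrum :
    ∃ (ι : Type) (s : ι → ℂ), ∀ g : ℝ → ℂ, IsWeilTest g →
      HasSum (fun i => weilMellin g (s i)) (weilFunctional g) :=
  ⟨(Σ ρ : ZetaZeros.riemannZetaNontrivialZeros, Fin (riemannZetaZeroOrder (ρ : ℂ)).toNat),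
    fun p => (p.1 : ℂ), fun _ hg => hasSum_weilMellin_zeros hg⟩

/-- Under RH every non-trivial zero reads `ρ = 1/2 + i·Im ρ`. [folklore] -/
theorem eq_half_add_of_riemannHypothesis (hRH : _root_.RiemannHypothesis)
    (ρ : ZetaZeros.riemannZetaNontrivialZeros) :
    (1 / 2 : ℂ) + (((ρ : ℂ).im : ℝ) : ℂ) * I = (ρ : ℂ) := by
  have hre : (ρ : ℂ).re = 1 / 2 := by
    refine hRH ρ (ZetaZeros.riemannZetaNontrivialZeros.zeta_eq_zero ρ.2) ?_
      (ZetaZeros.riemannZetaNontrivialZeros.ne_one ρ.2)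
    rintro ⟨n, hn⟩
    have h0 := ZetaZeros.riemannZetaNontrivialZeros.re_pos ρ.2
    rw [hn] at h0
    simp at h0
    linarith [n.cast_nonneg (α := ℝ)]
  apply Complex.ext <;> simp [hre]

/-- **Barrier reduction: `¬ WindowTraceArch → ¬ RH`.** Under RH the ordinates of the zeros,
repeated with multiplicity, witness the window trace on every window (indeed `X`); so an
unconditional refutation of the crux would refute the Riemann hypothesis. [folklore] -/
theorem not_riemannHypothesis_of_not_windowTraceArch
    (h : ¬ Summit.RiemannHypothesis.RiemannHypothesis.Theses.SpectralTrace.WindowTraceArch) :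
    ¬ _root_.RiemannHypothesis := by
  intro hRH
  refine h ⟨(Σ ρ : ZetaZeros.riemannZetaNontrivialZeros, Fin (riemannZetaZeroOrder (ρ : ℂ)).toNat),
    fun p => (p.1 : ℂ).im, fun g hg _ => ?_⟩
  simpa only [eq_half_add_of_riemannHypothesis hRH] using hasSum_weilMellin_zeros hg

end Summit.RiemannHypothesis.RiemannHypothesis.Theorems.WindowTraceArch.Negative

end
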